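import Summits.BirchSwinnertonDyer.Rank1Residual.X10.ResidualSelmerGeneratorTestRecord118810j1
import Summits.BirchSwinnertonDyer.Rank1Residual.X10.ResidualSelmerCompanions
import Summits.BirchSwinnertonDyer.Rank1Residual.X10.SelmerCompanionsTamagawaFree
import Summits.BirchSwinnertonDyer.Rank1Residual.GaloisImage.ThreeCongruenceHesseCertificateLemmas
import Literature.NumberTheory.EllipticCurves.Fisher2012.HesseFamilyThreeReverseProofs
import Summits.BirchSwinnertonDyer.BirchSwinnertonDyer.Theorems.Rank1ResidualIntModelReduction
import HarnessLib

/-!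
# N2 (X10b @ 3): THE 180th CELL `118810q1` — `S⁰(118810q1) = 0` IN THE KERNEL, through a DUAL HESSE
# CERTIFICATE `118810q1[3] ≃ 118810j1[3]` and the generator test (G) of its twin
# (cell `b2b-bsdres`, unit `b2b-bsdres-x10` = N2 class lead, GEN 32; RECORD — theorems only, no
# definition; named-fact hypotheses DISPLAYED: `poitouTate_selmerStructure_duality ℚ` (PT) and
# `selmerLocalKer_iff_of_goodReduction_above` (hMR = MR15 Thm. 3.1 (iv)(b)); census `#Sel₃(118810j1) = 3`;
# nothing booked)

HONEST FRAMING (run/shared/lean/b2b/bsd-rank1-residual/, verbatim in every file): the goal of the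
cell is to DELETE the COMBINATION-SHAPED residual classes of the Birch–Swinnerton-Dyer formula for
ALL analytic-rank `≤ 1` elliptic curves over `ℚ` — "full BSD formula for every rank `≤ 1` curve in
class `C`" assembled STRICTLY from published theorems — so that the rank-`≤ 1` remainder becomes
exactly the CONSTRUCTION-SHAPED classes, which are TYPED (missing-input `Prop`s), NOT attempted.
This is not "finishing BSD". Class X10b (= N2) keeps its label CONSTRUCTION-SHAPED (NEEDS `X_A3`,
referee R82.3 / RESIDUAL-MAP §I N2); this is a RECORD (evidence: the TRIVIAL-ROADS memo's row
"118810q1 — decided POSITIVELY by (G) at the twin" now read in the kernel); no mark / label / tier /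
count of record moves (179/313, floor 180 — census-lead's words, not this file's).

## What

`E = 118810q1 = [1, 1, 1, 10009495, −13156050473]` (non-split at `2`, analytic rank `0`, `Ш_an = 1`,
`dim Sel₃ = 0`; the ONE N2 cell the memo's trivial roads left "EVEN-open but decided positively by the
generator test at the `3`-congruent twin `118810j1`"). Two steps, both in the kernel:

* **`torsionIso_e118810q1_e118810j1`** : `TorsionIso 118810q1 118810j1 3` — `118810q1` is
  `ℚ`-isomorphic to the member `(l : m) = (763 : 23)`, `u = 1/109`, of the DUAL Hesse pencil
  `X_E⁻(3)` of `118810j1` (Fisher 2012 §13, tree THEOREM `thm132rev_threeCongruent_dualHessePencil_holds`;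
  ONE call of `VisCerts.torsionIso3_of_dualHesseCert_mk`, the two covariant identities `norm_num`;
  certificate found by n1011-p07 `certlib.cert_for` over n1011-r2 `hesse3lib`, 0.01 s). The
  congruence was KO-certified (traces) before; this is its kernel form.
* **`residualSelmerGroup_eq_bot_e118810q1`** : `S⁰(118810q1) = ⊥`, from
  `ResidualSelmerGeneratorTestRecord118810j1.residualSelmerGroup_eq_bot_e118810j1` (`S⁰(118810j1) = ⊥`:
  the Kummer class of `P = (187/9, 3262/27)` is RAMIFIED at the split `I₃` place `5`) transported along
  `θ` by `ResidualSelmerCompanions.residualSelmerGroup_eq_bot_iff_of_congr` (Mazur–Rubin: `S⁰` depends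
  on `E[p]` alone; both curves good at `3`: `3 ∤ Δ`, `decide`). CONDITIONAL on PT (through the twin's
  generator test), on hMR (the transport at the place `3`), and on the census `#Sel₃(118810j1) = 3`
  (x10b EXACT `3`-descent); nothing else.

References: [MazurRubin2007] Prop. 1.3 (i), Thm. 1.4; [MazurRubin2015SelmerCompanions] Thm. 3.1 (iv)(b);
[Fisher2012Hessian] §13; [Cremona2006] Table 1; HOME/class-closure/N2/TRIVIAL-ROADS-x10g27.md §3;
HOME/X10-AUDIT.md §38.9.
-/

set_option autoImplicit false

noncomputable section

open scoped Classical

open Function NumberField IsDedekindDomain Field WeierstrassCurve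
  Literature.NumberTheory.EllipticCurves Literature.NumberTheory.GaloisRepresentations
  Literature.NumberTheory.GaloisCohomology
  Literature.NumberTheory.EllipticCurves.MazurRubin2015
  Literature.NumberTheory.EllipticCurves.Fisher2012
  Summit.BirchSwinnertonDyer.BirchSwinnertonDyer.Rank1Residual.IntModel
  Summit.BirchSwinnertonDyer.BirchSwinnertonDyer.Theorems.Rank1ResidualX1Defs
  Summit.BirchSwinnertonDyer.Rank1Residual.X11b
  Summit.BirchSwinnertonDyer.Rank1Residual.GaloisImage
  Summit.BirchSwinnertonDyer.Rank1Residual.X1.CongruenceTransfer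
open Summit.BirchSwinnertonDyer.BirchSwinnertonDyer.Rank2Observatory.Tam
open Summit.BirchSwinnertonDyer.Rank1Residual.Additive
open Summit.BirchSwinnertonDyer.Rank1Residual.X10.ResidualSelmerGroup
open Summit.BirchSwinnertonDyer.Rank1Residual.X10.ResidualSelmerCompanions
open Summit.BirchSwinnertonDyer.Rank1Residual.X10.SelmerCompanionsTamagawaFree
open Summit.BirchSwinnertonDyer.Rank1Residual.X10.ResidualSelmerGeneratorTestRecord118810j1

namespace Summit.BirchSwinnertonDyer.Rank1Residual.X10.ResidualSelmerGeneratorTestRecord118810q1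

/-- **C1 IN THE KERNEL: `118810q1[3] ≃ 118810j1[3]` as `Γ_ℚ`-modules** (no named fact): `118810q1 =
[1, 1, 1, 10009495, −13156050473]` is `ℚ`-isomorphic to the member `(l : m) = (763 : 23)`, `u = 1/109`, of
the DUAL Hesse pencil `X_E⁻(3)` (Fisher 2012 §13; tree THEOREM
`thm132rev_threeCongruent_dualHessePencil_holds`) of `118810j1 = [1, 1, 0, 843, −9811]`
(`c₄, c₆ = −40439, 8780059` resp. `−480455759, 11370431026711`); the two covariant identities are
numeral identities (`norm_num`). [cite: Fisher2012Hessian, §13 (analogue of Thm. 13.2 for X_E^-(3)) and §8]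
[cite: Cremona2006, Table 1 (Cremona labels 118810j1, 118810q1)] -/
theorem torsionIso_e118810q1_e118810j1 (W A : WeierstrassCurve ℚ) [W.IsElliptic] [A.IsElliptic]
    (hW : W = ⟨1, 1, 0, 843, -9811⟩) (hA : A = ⟨1, 1, 1, 10009495, -13156050473⟩) :
    TorsionIso A W 3 :=
  VisCerts.torsionIso3_of_dualHesseCert_mk thm132rev_threeCongruent_dualHessePencil_holds
    hW hA
    (-40439 : ℚ) (8780059 : ℚ) (-480455759 : ℚ) (11370431026711 : ℚ)
    (by norm_num) (by norm_num) (by norm_num) (by norm_num)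
    (763 : ℚ) (23 : ℚ) ((1 : ℚ) / 109) (by norm_num) (by norm_num) (by norm_num)

/-- **`S⁰(118810q1) = ⊥` — the 180th N2 cell's residual Selmer group DECIDED IN THE KERNEL** (modulo
the displayed PT fact, hMR, and the twin's census `#Sel₃(118810j1) = 3`): the twin's generator test
`residualSelmerGroup_eq_bot_e118810j1` transported along the kernel congruence
`torsionIso_e118810q1_e118810j1` by `residualSelmerGroup_eq_bot_iff_of_congr` (both curves good at `3`).
Per cell; EVIDENCE for the TRIVIAL-ROADS row; nothing booked, no count moved here.
[cite: MazurRubin2007, Prop. 1.3 (i) and Thm. 1.4] [cite: MazurRubin2015SelmerCompanions, Thm. 3.1 (iv)(b)]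
[cite: Cremona2006, Table 1 (Cremona labels 118810q1, 118810j1)] -/
theorem residualSelmerGroup_eq_bot_e118810q1 (hfact : poitouTate_selmerStructure_duality ℚ)
    (hMR : selmerLocalKer_iff_of_goodReduction_above)
    (W A : WeierstrassCurve ℚ) [W.IsElliptic] [W.IsGloballyMinimal] [A.IsElliptic] [A.IsGloballyMinimal]
    (hIW : integralModelInt W = ⟨1, 1, 1, 10009495, -13156050473⟩)
    (hIA : integralModelInt A = ⟨1, 1, 0, 843, -9811⟩)
    (hsA : Nat.card (A.selmerGroup (3 : ℤ)) = 3) : residualSelmerGroup W 3 = ⊥ := by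
  -- the two curves as `ℚ`-literals (for the Hesse certificate)
  have hW : W = ⟨1, 1, 1, 10009495, -13156050473⟩ := by
    rw [IntModelTam.eq_baseChange_of_integralModelInt hIW]; ext <;> simp [baseChange, WeierstrassCurve.map]
  have hA : A = ⟨1, 1, 0, 843, -9811⟩ := by
    rw [IntModelTam.eq_baseChange_of_integralModelInt hIA]; ext <;> simp [baseChange, WeierstrassCurve.map]
  obtain ⟨θ, hθ⟩ := torsionIso_e118810q1_e118810j1 A W hA hW
  -- both good at `3` (`3 ∤ Δ`)
  have hgood : ∀ v : HeightOneSpectrum (𝓞 ℚ), ((3 : ℕ) : 𝓞 ℚ) ∈ v.asIdeal →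
      A.HasGoodReductionAt v ∧ W.HasGoodReductionAt v := fun v hv =>
    ⟨hasGoodReductionAt_of_map_eq_of_not_dvd (p := 3) A (hIA ▸ map_integralModelInt A)
        (by decide +kernel) v hv,
      hasGoodReductionAt_of_map_eq_of_not_dvd (p := 3) W (hIW ▸ map_integralModelInt W)
        (by decide +kernel) v hv⟩
  exact (residualSelmerGroup_eq_bot_iff_of_congr A W 3 hMR (by decide) θ hθ hgood).mpr
    (residualSelmerGroup_eq_bot_e118810j1 hfact A hIA hsA)

end Summit.BirchSwinnertonDyer.Rank1Residual.X10.ResidualSelmerGeneratorTestRecord118810q1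

end
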